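import Literature.AlgebraicGeometry.Motives.HodgeStructurePeriodDomainOpen
import Literature.AlgebraicGeometry.Motives.HodgeStructureTensorPolarization
import Literature.AlgebraicGeometry.Motives.HodgeStructureDeligneTorusTensor
import Mathlib.Analysis.InnerProductSpace.PiL2
import HarnessLib

/-!
# The Hodge norm of a tensor product of polarized Hodge structures: `‖x ⊗ y‖ = ‖x‖ ‖y‖`, Pythagoras along an orthonormal basis of one
# factor, and `‖(f ⊗ g)w‖ ≤ ‖f‖ ‖g‖ ‖w‖` — the uniform comparison of Hodge metrics is stable under `⊗`

Topic `Literature/AlgebraicGeometry/Motives` (namespace `Literature.AlgebraicGeometry.Motives.HodgeStructure[.Polarization]`), lane `lit-hodgefound`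
(seat `p08`, row g58-#2).  THEOREMS ONLY on the tree's `Polarization.hodgeNorm` (`Motives/HodgeStructurePeriodDomainOpen`: `‖x‖_h² =
Q_ℂ(Cx, x̄)`, the Hodge inner product `⟪x, y⟫ = Q_ℂ(Cy, x̄)` as a `def`-level inner product space), `Polarization.tensor` (`Motives/
HodgeStructureTensorPolarization`: the product polarization `Q₁ ⊗ Q₂` of `H₁ ⊗ H₂`) and `weilOperator_tensor` (`C(x ⊗ y) = C₁x ⊗ C₂y`);
no definition, no named fact, no instance (D-0026 net debt `0`).

PRINTED SOURCES.  J. Carlson, S. Müller-Stach, C. Peters, *Period Mappings and Period Domains* (2nd ed., 2017), §2.3 Thm. 2.3.3 / (2.6): «the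
hermitian form `h_C(φ, ψ) = Q(Cφ, ψ̄)` is positive definite» (the Hodge metric), and §15.1 Examples 15.1.2 (i) (the tensor product of Hodge
structures as a representation: `C = C₁ ⊗ C₂`, the product form).  E. Cattani, P. Deligne, A. Kaplan, *On the locus of Hodge classes*,
J. AMS 8 (1995), §1 (p. 484): «the hermitian form `h(u, v) = Q(Cu, v̄)` is positive definite and makes the Hodge decomposition orthogonal» —
used through flat trivializations, where one needs uniform comparisons `κ‖e(x)‖₀ ≤ ‖x‖` of Hodge metrics; this file shows such comparisons
survive the passage to `𝒱₁ ⊗ 𝒱₂`.  (The Hodge metric of a tensor product is the tensor product of the Hodge metrics, i.e. the Hilbert-space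
tensor norm — a cross norm.)

CONTENT.
* §0 (private) expansion of `u ∈ X ⊗_ℂ Y` along a finite basis of `X` or of `Y`: `u = Σᵢ eᵢ ⊗ πᵢ(u) = Σⱼ πⱼ′(u) ⊗ eⱼ′`.
* §1 naturality `(f ⊗ g)_ℂ(ι⁻¹(x ⊗ y)) = ι⁻¹(f_ℂx ⊗ g_ℂy)` of the reassociation `ι : ℂ ⊗ (V₁ ⊗ V₂) ≃ V₁,ℂ ⊗_ℂ V₂,ℂ`
  (`baseChange_map_tensorBaseChange_symm_tmul`).
* §2 **`h_{Q₁⊗Q₂}(x ⊗ y, x′ ⊗ y′) = h₁(x, x′)h₂(y, y′)`** (`tensor_form_weilOperator_conj_tmul`) and the cross-norm identity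
  **`‖x ⊗ y‖ = ‖x‖‖y‖`** (`hodgeNorm_tensor_tmul`); Pythagoras `‖Σ aᵢ ⊗ zᵢ‖² = Σ‖zᵢ‖²` for `(aᵢ)` Hodge-orthonormal (private), and the existence
  of a Hodge-orthonormal basis (Mathlib's `stdOrthonormalBasis` of the Hodge inner product space; private).
* §3 **operator norms multiply**: if `‖f_ℂx‖_{h₁′} ≤ c₁‖x‖_{h₁}` (all `x ∈ V₁,ℂ`) and `‖g_ℂy‖_{h₂′} ≤ c₂‖y‖_{h₂}` then
  `‖(1 ⊗ g)w‖ ≤ c₂‖w‖` (`hodgeNorm_map_id_baseChange_le`), `‖(f ⊗ 1)w‖ ≤ c₁‖w‖` (`hodgeNorm_map_baseChange_id_le`),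
  **`‖(f ⊗ g)_ℂw‖_{h₁′⊗h₂′} ≤ c₁c₂‖w‖_{h₁⊗h₂}`** (`hodgeNorm_map_baseChange_le`), and the chart form
  **`κ₁κ₂‖(f ⊗ g)_ℂw‖₀ ≤ ‖w‖`** from `κᵢ‖·‖₀ ≤ ‖·‖` (`mul_hodgeNorm_map_baseChange_le`).

All four spaces `V₁, V₂, V₁′, V₂′` live in one universe (the tree's `weilOperator_tensor` is stated in one universe).  Not here: the Hodge metric
of duals ∕ `Hom` ∕ tensor powers; the equality `‖f ⊗ g‖ = ‖f‖‖g‖`.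

## References

* [CarlsonMullerStachPeters2017] J. Carlson, S. Müller-Stach, C. Peters, *Period Mappings and Period Domains*, 2nd ed., CUP (2017): §2.3 Thm. 2.3.3
  and eq. (2.6); §15.1 Examples 15.1.2 (i).
* [CattaniDeligneKaplan1995] E. Cattani, P. Deligne, A. Kaplan, *On the locus of Hodge classes*, J. Amer. Math. Soc. 8 (1995), §1 (p. 484).
* [DeligneHodgeII1971] P. Deligne, *Théorie de Hodge II*, Publ. Math. IHÉS 40 (1971), 1.1.12, 2.1.15 (tensor products and their polarizations).
* [CattaniElZeinGriffithsLe2014] E. Cattani et al. (eds.), *Hodge Theory*, Math. Notes 49 (2014), §3.1.1.3 (1) (`(H ⊗ H′)_ℂ = H_ℂ ⊗ H′_ℂ`).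
-/

noncomputable section

open scoped TensorProduct ComplexOrder InnerProductSpace

namespace Literature.AlgebraicGeometry.Motives.HodgeStructure

universe u

/-! ## §0 Expansion of a tensor along a basis of the left or right factor -/

section Expansion

variable {X Y : Type*} [AddCommGroup X] [Module ℂ X] [AddCommGroup Y] [Module ℂ Y] {ι : Type*} [Fintype ι]

/-- **`u = Σ_i e_i ⊗ π_i(u)`** for every `u ∈ X ⊗ Y` and every finite basis `e` of `X`, with the `Y`-valued coordinates
`π_i(x ⊗ y) = e^*_i(x) • y` (`π_i = lift (e^*_i • ·)`). [folklore] -/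
private theorem sum_basis_tmul_leftCoord (e : Module.Basis ι ℂ X) (u : X ⊗[ℂ] Y) :
    ∑ i, e i ⊗ₜ[ℂ] TensorProduct.lift ((LinearMap.lsmul ℂ Y).comp (e.coord i)) u = u := by
  induction u using TensorProduct.induction_on with
  | zero => simp only [map_zero, TensorProduct.tmul_zero, Finset.sum_const_zero]
  | tmul x y =>
    simp only [TensorProduct.lift.tmul, LinearMap.comp_apply, Module.Basis.coord_apply, LinearMap.lsmul_apply, TensorProduct.tmul_smul,
      TensorProduct.smul_tmul']
    rw [← TensorProduct.sum_tmul, e.sum_repr]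
  | add u v hu hv =>
    simp only [map_add, TensorProduct.tmul_add, Finset.sum_add_distrib, hu, hv]

/-- **`u = Σ_j π_j(u) ⊗ e_j`** for every `u ∈ X ⊗ Y` and every finite basis `e` of `Y`, with the `X`-valued coordinates
`π_j(x ⊗ y) = e^*_j(y) • x`. [folklore] -/
private theorem sum_rightCoord_tmul_basis (e : Module.Basis ι ℂ Y) (u : X ⊗[ℂ] Y) :
    ∑ j, TensorProduct.lift ((LinearMap.lsmul ℂ X).flip.compl₂ (e.coord j)) u ⊗ₜ[ℂ] e j = u := by
  induction u using TensorProduct.induction_on with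
  | zero => simp only [map_zero, TensorProduct.zero_tmul, Finset.sum_const_zero]
  | tmul x y =>
    simp only [TensorProduct.lift.tmul, LinearMap.compl₂_apply, LinearMap.flip_apply, Module.Basis.coord_apply, LinearMap.lsmul_apply,
      ← TensorProduct.smul_tmul', ← TensorProduct.tmul_smul]
    rw [← TensorProduct.tmul_sum, e.sum_repr]
  | add u v hu hv =>
    simp only [map_add, TensorProduct.add_tmul, Finset.sum_add_distrib, hu, hv]

end Expansion

/-! ## §1 Naturality of the reassociation along `f ⊗ g` -/

section Naturality

variable {M₁ M₂ V₁ V₂ : Type u} [AddCommGroup M₁] [Module ℚ M₁] [AddCommGroup M₂] [Module ℚ M₂] [AddCommGroup V₁] [Module ℚ V₁]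
  [AddCommGroup V₂] [Module ℚ V₂]

/-- Naturality of the reassociation: `ι((f ⊗ g)_ℂ x) = (f_ℂ ⊗ g_ℂ)(ι x)`. [folklore] -/
private theorem tensorBaseChange_baseChange_map_apply' (f : M₁ →ₗ[ℚ] V₁) (g : M₂ →ₗ[ℚ] V₂) (x : ℂ ⊗[ℚ] (M₁ ⊗[ℚ] M₂)) :
    tensorBaseChange V₁ V₂ ((TensorProduct.map f g).baseChange ℂ x) =
      TensorProduct.map (f.baseChange ℂ) (g.baseChange ℂ) (tensorBaseChange M₁ M₂ x) := by
  induction x using TensorProduct.induction_on with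
  | zero => simp only [map_zero]
  | add x y hx hy => simp only [map_add, hx, hy]
  | tmul c z =>
    induction z using TensorProduct.induction_on with
    | zero => simp only [TensorProduct.tmul_zero, map_zero]
    | add x y hx hy => simp only [TensorProduct.tmul_add, map_add, hx, hy]
    | tmul v w =>
      simp only [LinearMap.baseChange_tmul, TensorProduct.map_tmul, tensorBaseChange_tmul]

/-- **`(f ⊗ g)_ℂ (ι⁻¹(x ⊗ y)) = ι⁻¹(f_ℂ x ⊗ g_ℂ y)`** for the reassociations `ι : ℂ ⊗ (· ⊗ ·) ≃ (·)_ℂ ⊗_ℂ (·)_ℂ` («`(H ⊗ H′)_ℂ = H_ℂ ⊗ H′_ℂ`»,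
functorially in `H`, `H′`). [cite: CattaniElZeinGriffithsLe2014, §3.1.1.3 (1)] -/
theorem baseChange_map_tensorBaseChange_symm_tmul (f : M₁ →ₗ[ℚ] V₁) (g : M₂ →ₗ[ℚ] V₂) (x : ℂ ⊗[ℚ] M₁) (y : ℂ ⊗[ℚ] M₂) :
    (TensorProduct.map f g).baseChange ℂ ((tensorBaseChange M₁ M₂).symm (x ⊗ₜ[ℂ] y)) =
      (tensorBaseChange V₁ V₂).symm (f.baseChange ℂ x ⊗ₜ[ℂ] g.baseChange ℂ y) := by
  apply (tensorBaseChange V₁ V₂).injective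
  rw [tensorBaseChange_baseChange_map_apply', LinearEquiv.apply_symm_apply, LinearEquiv.apply_symm_apply, TensorProduct.map_tmul]

end Naturality


/-! ## §2 The Hodge inner product and Hodge norm of a tensor product -/

namespace Polarization

section Tensor

variable {V₁ V₂ : Type u} [AddCommGroup V₁] [Module ℚ V₁] [AddCommGroup V₂] [Module ℚ V₂] {n m : ℤ}
variable [HodgeTensorFacts.{u, u}] [Module.Finite ℚ V₁] [Module.Finite ℚ V₂]
variable {H₁ : HodgeStructure V₁ n} {H₂ : HodgeStructure V₂ m} (P₁ : Polarization H₁) (P₂ : Polarization H₂)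

/-- **The Hodge form of `H₁ ⊗ H₂` with the product polarization on pure tensors**:
`h(x ⊗ y, x′ ⊗ y′) = h₁(x, x′) h₂(y, y′)`, i.e. `(Q₁ ⊗ Q₂)_ℂ(C(x′ ⊗ y′), conj(x ⊗ y)) = Q₁,ℂ(C₁x′, x̄) Q₂,ℂ(C₂y′, ȳ)`
(`C = C₁ ⊗ C₂`, `conj(x ⊗ y) = x̄ ⊗ ȳ`). [cite: CarlsonMullerStachPeters2017, §2.3 Thm. 2.3.3 and §15.1 Examples 15.1.2 (i)] -/
theorem tensor_form_weilOperator_conj_tmul (x x' : ℂ ⊗[ℚ] V₁) (y y' : ℂ ⊗[ℚ] V₂) :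
    (P₁.tensor P₂).form.baseChange ℂ ((H₁.tensor H₂).weilOperator ((tensorBaseChange V₁ V₂).symm (x' ⊗ₜ[ℂ] y')))
        (conj ((tensorBaseChange V₁ V₂).symm (x ⊗ₜ[ℂ] y))) =
      P₁.form.baseChange ℂ (H₁.weilOperator x') (conj x) * P₂.form.baseChange ℂ (H₂.weilOperator y') (conj y) := by
  rw [weilOperator_tensor, conj_tensorBaseChange_symm_tmul, Polarization.tensor_form, Polarization.tensorForm₂C_symm_tmul]

/-- **The Hodge norm is a cross norm: `‖x ⊗ y‖_{h₁ ⊗ h₂} = ‖x‖_{h₁} ‖y‖_{h₂}`.** [cite: CarlsonMullerStachPeters2017, §2.3 Thm. 2.3.3 and §15.1 Examples 15.1.2 (i)] -/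
theorem hodgeNorm_tensor_tmul (x : ℂ ⊗[ℚ] V₁) (y : ℂ ⊗[ℚ] V₂) :
    (P₁.tensor P₂).hodgeNorm ((tensorBaseChange V₁ V₂).symm (x ⊗ₜ[ℂ] y)) = P₁.hodgeNorm x * P₂.hodgeNorm y := by
  have h := P₁.tensor_form_weilOperator_conj_tmul P₂ x x y y
  rw [Polarization.form_weilOperator_conj_self_eq_hodgeNorm_sq, Polarization.form_weilOperator_conj_self_eq_hodgeNorm_sq,
    Polarization.form_weilOperator_conj_self_eq_hodgeNorm_sq] at h
  have h' : (P₁.tensor P₂).hodgeNorm ((tensorBaseChange V₁ V₂).symm (x ⊗ₜ[ℂ] y)) ^ 2 = (P₁.hodgeNorm x * P₂.hodgeNorm y) ^ 2 := by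
    rw [mul_pow]; exact_mod_cast h
  exact (pow_left_inj₀ (Polarization.hodgeNorm_nonneg _ _)
    (mul_nonneg (Polarization.hodgeNorm_nonneg _ _) (Polarization.hodgeNorm_nonneg _ _)) two_ne_zero).1 h'

/-- `‖Σ_i a_i ⊗ z_i‖² = Σ_i ‖z_i‖²` for a family `(a_i)` orthonormal for the Hodge form `h₁` (Pythagoras in `h₁ ⊗ h₂`). [folklore] -/
private theorem hodgeNorm_sq_sum_tmul_left {ι : Type*} [Fintype ι] [DecidableEq ι] (a : ι → ℂ ⊗[ℚ] V₁)
    (ha : ∀ i j, P₁.form.baseChange ℂ (H₁.weilOperator (a j)) (conj (a i)) = if i = j then 1 else 0) (z : ι → ℂ ⊗[ℚ] V₂) :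
    (P₁.tensor P₂).hodgeNorm (∑ i, (tensorBaseChange V₁ V₂).symm (a i ⊗ₜ[ℂ] z i)) ^ 2 = ∑ i, P₂.hodgeNorm (z i) ^ 2 := by
  have h : (P₁.tensor P₂).form.baseChange ℂ ((H₁.tensor H₂).weilOperator (∑ j, (tensorBaseChange V₁ V₂).symm (a j ⊗ₜ[ℂ] z j)))
      (conj (∑ i, (tensorBaseChange V₁ V₂).symm (a i ⊗ₜ[ℂ] z i))) =
      ∑ i, P₂.form.baseChange ℂ (H₂.weilOperator (z i)) (conj (z i)) := by
    simp only [map_sum, LinearMap.sum_apply, tensor_form_weilOperator_conj_tmul, ha, ite_mul, one_mul, zero_mul,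
      Finset.sum_ite_eq, Finset.mem_univ, if_true]
  rw [Polarization.form_weilOperator_conj_self_eq_hodgeNorm_sq] at h
  simp only [Polarization.form_weilOperator_conj_self_eq_hodgeNorm_sq] at h
  exact_mod_cast h

/-- `‖Σ_j z_j ⊗ b_j‖² = Σ_j ‖z_j‖²` for a family `(b_j)` orthonormal for `h₂`. [folklore] -/
private theorem hodgeNorm_sq_sum_tmul_right {ι : Type*} [Fintype ι] [DecidableEq ι] (b : ι → ℂ ⊗[ℚ] V₂)
    (hb : ∀ i j, P₂.form.baseChange ℂ (H₂.weilOperator (b j)) (conj (b i)) = if i = j then 1 else 0) (z : ι → ℂ ⊗[ℚ] V₁) :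
    (P₁.tensor P₂).hodgeNorm (∑ j, (tensorBaseChange V₁ V₂).symm (z j ⊗ₜ[ℂ] b j)) ^ 2 = ∑ j, P₁.hodgeNorm (z j) ^ 2 := by
  have h : (P₁.tensor P₂).form.baseChange ℂ ((H₁.tensor H₂).weilOperator (∑ j, (tensorBaseChange V₁ V₂).symm (z j ⊗ₜ[ℂ] b j)))
      (conj (∑ i, (tensorBaseChange V₁ V₂).symm (z i ⊗ₜ[ℂ] b i))) =
      ∑ i, P₁.form.baseChange ℂ (H₁.weilOperator (z i)) (conj (z i)) := by
    simp only [map_sum, LinearMap.sum_apply, tensor_form_weilOperator_conj_tmul, hb, mul_ite, mul_one, mul_zero,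
      Finset.sum_ite_eq, Finset.mem_univ, if_true]
  rw [Polarization.form_weilOperator_conj_self_eq_hodgeNorm_sq] at h
  simp only [Polarization.form_weilOperator_conj_self_eq_hodgeNorm_sq] at h
  exact_mod_cast h

omit [HodgeTensorFacts.{u, u}] [Module.Finite ℚ V₁] [Module.Finite ℚ V₂] in
/-- An orthonormal basis of `V_ℂ` for the Hodge form of a polarization (Gram–Schmidt; Mathlib's `stdOrthonormalBasis` for the Hodge inner
product space). [folklore] -/
private theorem exists_hodge_orthonormalBasis {V : Type u} [AddCommGroup V] [Module ℚ V] [Module.Finite ℚ V] {k : ℤ} {H : HodgeStructure V k}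
    (P : Polarization H) :
    ∃ (d : ℕ) (b : Module.Basis (Fin d) ℂ (ℂ ⊗[ℚ] V)),
      ∀ i j, P.form.baseChange ℂ (H.weilOperator (b j)) (conj (b i)) = if i = j then 1 else 0 := by
  letI := P.hodgeNormedAddCommGroup
  letI := P.hodgeInnerProductSpace
  let b := stdOrthonormalBasis ℂ (ℂ ⊗[ℚ] V)
  refine ⟨_, b.toBasis, fun i j => ?_⟩
  rw [OrthonormalBasis.coe_toBasis, ← P.inner_eq]
  exact orthonormal_iff_ite.1 b.orthonormal i j

end Tensor

/-! ## §3 Operator norms multiply: `‖(f ⊗ g)w‖ ≤ ‖f‖ ‖g‖ ‖w‖` for the Hodge norms -/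

section Operator

variable {M₁ M₂ V₁ V₂ : Type u} [AddCommGroup M₁] [Module ℚ M₁] [AddCommGroup M₂] [Module ℚ M₂] [AddCommGroup V₁] [Module ℚ V₁]
  [AddCommGroup V₂] [Module ℚ V₂] {n m : ℤ}
variable [HodgeTensorFacts.{u, u}] [Module.Finite ℚ M₁] [Module.Finite ℚ M₂] [Module.Finite ℚ V₁] [Module.Finite ℚ V₂]
variable {H₁ : HodgeStructure M₁ n} {H₂ : HodgeStructure M₂ m} {H₁' : HodgeStructure V₁ n} {H₂' : HodgeStructure V₂ m}

/-- **`‖(1 ⊗ g)w‖_{h₁ ⊗ h₂′} ≤ c ‖w‖_{h₁ ⊗ h₂}` when `‖g_ℂ y‖_{h₂′} ≤ c ‖y‖_{h₂}` for all `y`** (expand `w = Σ aᵢ ⊗ zᵢ` along an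
`h₁`-orthonormal basis: `‖(1 ⊗ g)w‖² = Σ ‖g zᵢ‖² ≤ c² Σ ‖zᵢ‖² = c²‖w‖²`). [cite: CarlsonMullerStachPeters2017, §2.3 Thm. 2.3.3 and §15.1 Examples 15.1.2 (i)] -/
theorem hodgeNorm_map_id_baseChange_le (P₁ : Polarization H₁) (P₂ : Polarization H₂) (P₂' : Polarization H₂') (g : M₂ →ₗ[ℚ] V₂)
    {c : ℝ} (hc : 0 ≤ c) (hg : ∀ y : ℂ ⊗[ℚ] M₂, P₂'.hodgeNorm (g.baseChange ℂ y) ≤ c * P₂.hodgeNorm y) (w : ℂ ⊗[ℚ] (M₁ ⊗[ℚ] M₂)) :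
    (P₁.tensor P₂').hodgeNorm ((TensorProduct.map LinearMap.id g).baseChange ℂ w) ≤ c * (P₁.tensor P₂).hodgeNorm w := by
  obtain ⟨d, b, hb⟩ := exists_hodge_orthonormalBasis P₁
  obtain ⟨u, hu⟩ : ∃ u, tensorBaseChange M₁ M₂ w = u := ⟨_, rfl⟩
  have hw : w = ∑ i, (tensorBaseChange M₁ M₂).symm (b i ⊗ₜ[ℂ] TensorProduct.lift ((LinearMap.lsmul ℂ (ℂ ⊗[ℚ] M₂)).comp (b.coord i)) u) := by
    apply (tensorBaseChange M₁ M₂).injective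
    simp only [map_sum, LinearEquiv.apply_symm_apply, sum_basis_tmul_leftCoord, hu]
  have hgw : (TensorProduct.map LinearMap.id g).baseChange ℂ w =
      ∑ i, (tensorBaseChange M₁ V₂).symm (b i ⊗ₜ[ℂ] g.baseChange ℂ (TensorProduct.lift ((LinearMap.lsmul ℂ (ℂ ⊗[ℚ] M₂)).comp (b.coord i)) u)) := by
    rw [hw, map_sum]
    simp only [baseChange_map_tensorBaseChange_symm_tmul, LinearMap.baseChange_id, LinearMap.id_apply]
  have h1 : (P₁.tensor P₂').hodgeNorm ((TensorProduct.map LinearMap.id g).baseChange ℂ w) ^ 2 ≤ (c * (P₁.tensor P₂).hodgeNorm w) ^ 2 := by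
    rw [hgw, P₁.hodgeNorm_sq_sum_tmul_left P₂' b hb, mul_pow, hw, P₁.hodgeNorm_sq_sum_tmul_left P₂ b hb, Finset.mul_sum]
    refine Finset.sum_le_sum fun i _ => ?_
    rw [← mul_pow]
    exact pow_le_pow_left₀ (Polarization.hodgeNorm_nonneg _ _) (hg _) 2
  exact (pow_le_pow_iff_left₀ (Polarization.hodgeNorm_nonneg _ _) (mul_nonneg hc (Polarization.hodgeNorm_nonneg _ _))
    two_ne_zero).1 h1

/-- **`‖(f ⊗ 1)w‖_{h₁′ ⊗ h₂} ≤ c ‖w‖_{h₁ ⊗ h₂}` when `‖f_ℂ x‖_{h₁′} ≤ c ‖x‖_{h₁}` for all `x`** (expansion along an `h₂`-orthonormal basis).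
[cite: CarlsonMullerStachPeters2017, §2.3 Thm. 2.3.3 and §15.1 Examples 15.1.2 (i)] -/
theorem hodgeNorm_map_baseChange_id_le (P₁ : Polarization H₁) (P₂ : Polarization H₂) (P₁' : Polarization H₁') (f : M₁ →ₗ[ℚ] V₁)
    {c : ℝ} (hc : 0 ≤ c) (hf : ∀ x : ℂ ⊗[ℚ] M₁, P₁'.hodgeNorm (f.baseChange ℂ x) ≤ c * P₁.hodgeNorm x) (w : ℂ ⊗[ℚ] (M₁ ⊗[ℚ] M₂)) :
    (P₁'.tensor P₂).hodgeNorm ((TensorProduct.map f LinearMap.id).baseChange ℂ w) ≤ c * (P₁.tensor P₂).hodgeNorm w := by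
  obtain ⟨d, b, hb⟩ := exists_hodge_orthonormalBasis P₂
  obtain ⟨u, hu⟩ : ∃ u, tensorBaseChange M₁ M₂ w = u := ⟨_, rfl⟩
  have hw : w = ∑ j, (tensorBaseChange M₁ M₂).symm (TensorProduct.lift ((LinearMap.lsmul ℂ (ℂ ⊗[ℚ] M₁)).flip.compl₂ (b.coord j)) u ⊗ₜ[ℂ] b j) := by
    apply (tensorBaseChange M₁ M₂).injective
    simp only [map_sum, LinearEquiv.apply_symm_apply, sum_rightCoord_tmul_basis, hu]
  have hfw : (TensorProduct.map f LinearMap.id).baseChange ℂ w =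
      ∑ j, (tensorBaseChange V₁ M₂).symm (f.baseChange ℂ (TensorProduct.lift ((LinearMap.lsmul ℂ (ℂ ⊗[ℚ] M₁)).flip.compl₂ (b.coord j)) u) ⊗ₜ[ℂ] b j) := by
    rw [hw, map_sum]
    simp only [baseChange_map_tensorBaseChange_symm_tmul, LinearMap.baseChange_id, LinearMap.id_apply]
  have h1 : (P₁'.tensor P₂).hodgeNorm ((TensorProduct.map f LinearMap.id).baseChange ℂ w) ^ 2 ≤ (c * (P₁.tensor P₂).hodgeNorm w) ^ 2 := by
    rw [hfw, P₁'.hodgeNorm_sq_sum_tmul_right P₂ b hb, mul_pow, hw, P₁.hodgeNorm_sq_sum_tmul_right P₂ b hb, Finset.mul_sum]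
    refine Finset.sum_le_sum fun j _ => ?_
    rw [← mul_pow]
    exact pow_le_pow_left₀ (Polarization.hodgeNorm_nonneg _ _) (hf _) 2
  exact (pow_le_pow_iff_left₀ (Polarization.hodgeNorm_nonneg _ _) (mul_nonneg hc (Polarization.hodgeNorm_nonneg _ _))
    two_ne_zero).1 h1

/-- **Operator norms multiply for the Hodge norms: if `‖f_ℂ x‖_{h₁′} ≤ c₁‖x‖_{h₁}` and `‖g_ℂ y‖_{h₂′} ≤ c₂‖y‖_{h₂}` then
`‖(f ⊗ g)_ℂ w‖_{h₁′ ⊗ h₂′} ≤ c₁c₂ ‖w‖_{h₁ ⊗ h₂}`** for every `w ∈ (M₁ ⊗ M₂)_ℂ` (`f ⊗ g = (f ⊗ 1)(1 ⊗ g)`; the Hodge norm of a tensor product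
of polarized Hodge structures is the Hilbert tensor norm). [cite: CarlsonMullerStachPeters2017, §2.3 Thm. 2.3.3 and §15.1 Examples 15.1.2 (i)] -/
theorem hodgeNorm_map_baseChange_le (P₁ : Polarization H₁) (P₂ : Polarization H₂) (P₁' : Polarization H₁') (P₂' : Polarization H₂')
    (f : M₁ →ₗ[ℚ] V₁) (g : M₂ →ₗ[ℚ] V₂) {c₁ c₂ : ℝ} (hc₁ : 0 ≤ c₁) (hc₂ : 0 ≤ c₂)
    (hf : ∀ x : ℂ ⊗[ℚ] M₁, P₁'.hodgeNorm (f.baseChange ℂ x) ≤ c₁ * P₁.hodgeNorm x)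
    (hg : ∀ y : ℂ ⊗[ℚ] M₂, P₂'.hodgeNorm (g.baseChange ℂ y) ≤ c₂ * P₂.hodgeNorm y) (w : ℂ ⊗[ℚ] (M₁ ⊗[ℚ] M₂)) :
    (P₁'.tensor P₂').hodgeNorm ((TensorProduct.map f g).baseChange ℂ w) ≤ c₁ * c₂ * (P₁.tensor P₂).hodgeNorm w := by
  have hfg : TensorProduct.map f g = TensorProduct.map f LinearMap.id ∘ₗ TensorProduct.map LinearMap.id g := by
    rw [← TensorProduct.map_comp, LinearMap.comp_id, LinearMap.id_comp]
  rw [hfg, LinearMap.baseChange_comp, LinearMap.comp_apply]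
  calc (P₁'.tensor P₂').hodgeNorm ((TensorProduct.map f LinearMap.id).baseChange ℂ ((TensorProduct.map LinearMap.id g).baseChange ℂ w))
      ≤ c₁ * (P₁.tensor P₂').hodgeNorm ((TensorProduct.map LinearMap.id g).baseChange ℂ w) :=
        hodgeNorm_map_baseChange_id_le P₁ P₂' P₁' f hc₁ hf _
    _ ≤ c₁ * (c₂ * (P₁.tensor P₂).hodgeNorm w) := mul_le_mul_of_nonneg_left (hodgeNorm_map_id_baseChange_le P₁ P₂ P₂' g hc₂ hg w) hc₁
    _ = c₁ * c₂ * (P₁.tensor P₂).hodgeNorm w := by ring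

/-- **The uniform comparison of Hodge metrics is stable under `⊗`** (the form used by local period charts): if `κ₁‖f_ℂ x‖₀ ≤ ‖x‖` and
`κ₂‖g_ℂ y‖₀ ≤ ‖y‖` with `κᵢ > 0`, then `κ₁κ₂ ‖(f ⊗ g)_ℂ w‖₀ ≤ ‖w‖` for every `w ∈ (M₁ ⊗ M₂)_ℂ`.
[cite: CarlsonMullerStachPeters2017, §2.3 Thm. 2.3.3 and §15.1 Examples 15.1.2 (i)] [cite: CattaniDeligneKaplan1995, §1 (p. 484)] -/
theorem mul_hodgeNorm_map_baseChange_le (P₁ : Polarization H₁) (P₂ : Polarization H₂) (P₁' : Polarization H₁') (P₂' : Polarization H₂')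
    (f : M₁ →ₗ[ℚ] V₁) (g : M₂ →ₗ[ℚ] V₂) {κ₁ κ₂ : ℝ} (hκ₁ : 0 < κ₁) (hκ₂ : 0 < κ₂)
    (hf : ∀ x : ℂ ⊗[ℚ] M₁, κ₁ * P₁'.hodgeNorm (f.baseChange ℂ x) ≤ P₁.hodgeNorm x)
    (hg : ∀ y : ℂ ⊗[ℚ] M₂, κ₂ * P₂'.hodgeNorm (g.baseChange ℂ y) ≤ P₂.hodgeNorm y) (w : ℂ ⊗[ℚ] (M₁ ⊗[ℚ] M₂)) :
    κ₁ * κ₂ * (P₁'.tensor P₂').hodgeNorm ((TensorProduct.map f g).baseChange ℂ w) ≤ (P₁.tensor P₂).hodgeNorm w := by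
  have hf' : ∀ x : ℂ ⊗[ℚ] M₁, P₁'.hodgeNorm (f.baseChange ℂ x) ≤ κ₁⁻¹ * P₁.hodgeNorm x := fun x => by
    rw [← div_eq_inv_mul, le_div_iff₀ hκ₁, mul_comm]; exact hf x
  have hg' : ∀ y : ℂ ⊗[ℚ] M₂, P₂'.hodgeNorm (g.baseChange ℂ y) ≤ κ₂⁻¹ * P₂.hodgeNorm y := fun y => by
    rw [← div_eq_inv_mul, le_div_iff₀ hκ₂, mul_comm]; exact hg y
  have h := hodgeNorm_map_baseChange_le P₁ P₂ P₁' P₂' f g (inv_nonneg.2 hκ₁.le) (inv_nonneg.2 hκ₂.le) hf' hg' w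
  have hκ : 0 < κ₁ * κ₂ := mul_pos hκ₁ hκ₂
  calc κ₁ * κ₂ * (P₁'.tensor P₂').hodgeNorm ((TensorProduct.map f g).baseChange ℂ w)
      ≤ κ₁ * κ₂ * (κ₁⁻¹ * κ₂⁻¹ * (P₁.tensor P₂).hodgeNorm w) := mul_le_mul_of_nonneg_left h hκ.le
    _ = (P₁.tensor P₂).hodgeNorm w := by field_simp

end Operator

end Polarization

end Literature.AlgebraicGeometry.Motives.HodgeStructure

end
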